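import Literature.Geometry.Lorentzian.ADMFrameIndependence
import Literature.Geometry.Lorentzian.Basic
import Mathlib.Geometry.Manifold.PartitionOfUnity

/-!
# Window charges (stub `stub_windowCharges`): curl fields have no flux through coordinate spheres

Helper file for the line `sublinear-is-free-clean-window-charges` of the crux `InertialRecession`
(item `stmt-FinalStateConjecture-10166`), stub `stub_windowCharges` (quantitative window charges of
Landau–Lifshitz quasi-local momenta along moving coordinate spheres).

The one piece of surface calculus behind the transport theorem for the flux
`P(t) = ∮_{S_t} Σ_j h^{μ0j} n_j dσ` through a MOVING closed coordinate sphere is Stokes' theorem on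
the sphere in flux form: for an antisymmetric matrix field `A_{jk} = −A_{kj}` which is `C²` on a
neighbourhood of the round sphere `{‖z‖ = ρ}` of `E3`,

  `∫_{S²} Σ_j (Σ_k ∂_k A_{jk})(ρ α) α_j dτ(α) = 0`

(`τ = volume.toSphere`, the polar surface measure on the unit sphere): the vector field
`Σ_k ∂_k A_{jk}` is a curl. The tree has this for GLOBALLY `C²` fields vanishing on a small ball
(`Literature.Geometry.Lorentzian.sphereIntegral_admVec_eq_zero_of_antisymm`, Gauss–Green on a
shell); here it is localised with a smooth cut-off equal to `1` near the sphere
(`exists_cutoff_sphere`, Mathlib's smooth Urysohn lemma), since the Landau–Lifshitz fields of the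
application are only defined near the sphere (black holes may sit inside).
-/

noncomputable section

-- instance search on the nested operator spaces `E3 →L[ℝ] E3 →L[ℝ] ℝ` is deep
set_option maxSynthPendingDepth 3

open Set Filter Metric MeasureTheory
open scoped Topology ContDiff RealInnerProductSpace Manifold

namespace Summit.FinalStateConjecture.FinalStateConjecture.Theorems.SublinearIsFree.WindowCharges

open Literature.Geometry.Lorentzian

/-! ### A smooth cut-off equal to one near a sphere -/

/-- **Smooth cut-off near a round sphere.** If the open set `U ⊆ E3` contains the sphere
`{‖z‖ = ρ}` (`ρ > 0`), there is a `C^∞` function `χ` with `χ = 1` near every point of the sphere,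
`tsupport χ ⊆ U`, and `χ = 0` on the closed ball of radius `ρ / 2` (Mathlib's smooth Urysohn lemma
`exists_contMDiffMap_zero_one_nhds_of_isClosed` on `E3`). [folklore] -/
theorem exists_cutoff_sphere {U : Set E3} (hU : IsOpen U) {ρ : ℝ} (hρ : 0 < ρ)
    (hsub : sphere (0 : E3) ρ ⊆ U) :
    ∃ χ : E3 → ℝ, ContDiff ℝ ∞ χ ∧ (∀ x ∈ sphere (0 : E3) ρ, χ =ᶠ[𝓝 x] fun _ ↦ 1) ∧
      tsupport χ ⊆ U ∧ ∀ x, ‖x‖ ≤ ρ / 2 → χ x = 0 := by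
  set V : Set E3 := U ∩ (closedBall (0 : E3) (ρ / 2))ᶜ with hV
  have hVo : IsOpen V := hU.inter isClosed_closedBall.isOpen_compl
  have hsV : sphere (0 : E3) ρ ⊆ V := fun x hx ↦ ⟨hsub hx, fun h ↦ by
    rw [mem_closedBall, dist_zero_right] at h
    rw [mem_sphere_zero_iff_norm] at hx
    linarith⟩
  obtain ⟨f, hf0, hf1, -⟩ := exists_contMDiffMap_zero_one_nhds_of_isClosed (I := 𝓘(ℝ, E3))
    (M := E3) (n := (⊤ : ℕ∞)) hVo.isClosed_compl isClosed_sphere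
    (disjoint_compl_left_iff.2 hsV)
  refine ⟨f, f.contMDiff.contDiff, fun x hx ↦ ?_, fun x hx ↦ ?_, fun x hx ↦ ?_⟩
  · exact (eventually_nhdsSet_iff_forall.1 hf1) x hx
  · by_contra hxU
    have hxV : x ∈ Vᶜ := fun h ↦ hxU h.1
    have h0 : (fun y ↦ (f : E3 → ℝ) y) =ᶠ[𝓝 x] 0 := by
      filter_upwards [(eventually_nhdsSet_iff_forall.1 hf0) x hxV] with y hy
      exact hy
    exact (notMem_tsupport_iff_eventuallyEq.2 h0) hx
  · have hxV : x ∈ Vᶜ := fun h ↦ h.2 (mem_closedBall.2 (by simpa using hx))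
    exact hf0.self_of_nhdsSet x hxV


/-! ### Bilinear forms on `E3` from matrices -/

/-- The bilinear form `(v, w) ↦ Σ_{ij} M_{ij} v_i w_j` on `E3`, evaluated. [folklore] -/
theorem sum_smul_smulRight_apply (M : Fin 3 → Fin 3 → ℝ) (v w : E3) :
    (∑ i : Fin 3, ∑ j : Fin 3, M i j • (EuclideanSpace.proj i : E3 →L[ℝ] ℝ).smulRight
      (EuclideanSpace.proj j : E3 →L[ℝ] ℝ)) v w = ∑ i : Fin 3, ∑ j : Fin 3, M i j * v i * w j := by
  simp only [_root_.sum_apply, _root_.smul_apply, ContinuousLinearMap.smulRight_apply,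
    smul_eq_mul, PiLp.proj_apply]
  refine Finset.sum_congr rfl fun i _ ↦ Finset.sum_congr rfl fun j _ ↦ ?_
  ring

/-- The matrix entries are the values on the standard basis vectors. [folklore] -/
theorem sum_smul_smulRight_single (M : Fin 3 → Fin 3 → ℝ) (i j : Fin 3) :
    (∑ i' : Fin 3, ∑ j' : Fin 3, M i' j' • (EuclideanSpace.proj i' : E3 →L[ℝ] ℝ).smulRight
      (EuclideanSpace.proj j' : E3 →L[ℝ] ℝ)) (EuclideanSpace.single i 1)
        (EuclideanSpace.single j 1) = M i j := by
  rw [sum_smul_smulRight_apply]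
  simp only [PiLp.single_apply, mul_ite, mul_one, mul_zero, Finset.sum_ite_eq',
    Finset.mem_univ, if_true]

/-! ### Stokes' theorem on the round sphere, flux form, for fields defined near the sphere -/

/-- **Curl fields defined near a round sphere have no flux through it.** Let
`A_{ij} = −A_{ji}` (`i, j < 3`) be real functions on `E3` which are `C²` on an open set `U`
containing the sphere `{‖z‖ = ρ}`, `ρ > 0`. Then the flux of the vector field
`c_i = Σ_j ∂_j A_{ij}` through the sphere vanishes:
`∫ Σ_i (Σ_j ∂_j A_{ij})(ρ α) α_i dτ(α) = 0`, `τ = volume.toSphere` the polar surface measure on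
the unit sphere (so that `ρ² ∫ … dτ` is the surface integral over `{‖z‖ = ρ}`). Proof: multiply
by a smooth cut-off `χ = 1` near the sphere with `tsupport χ ⊆ U`, `χ = 0` on `{‖z‖ ≤ ρ/2}`
(`exists_cutoff_sphere`) and apply the global statement
`Literature.Geometry.Lorentzian.sphereIntegral_admVec_eq_zero_of_antisymm` (Gauss–Green on the
shell `{ρ/2 < ‖z‖ < ρ}` for the divergence-free field `c`). This is `∮ curl · n dσ = 0` for the
closed surface `S_ρ` (Stokes), in the index form used by Landau–Lifshitz §96 for the term
`∮ Σ_k ∂_k h^{μjk} n_j` of the momentum balance. [folklore] -/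
theorem toSphere_integral_sum_fderiv_antisymm_eq_zero' {A : Fin 3 → Fin 3 → E3 → ℝ} {U : Set E3}
    (hU : IsOpen U) {ρ : ℝ} (hρ : 0 < ρ) (hsub : sphere (0 : E3) ρ ⊆ U)
    (hA : ∀ i j, ContDiffOn ℝ 2 (A i j) U) (hanti : ∀ i j z, A i j z = -A j i z) :
    ∫ α : sphere (0 : E3) 1, ∑ i : Fin 3, (∑ j : Fin 3,
      fderiv ℝ (A i j) (ρ • (α : E3)) (EuclideanSpace.single j 1)) * (α : E3) i
        ∂(volume : Measure E3).toSphere = 0 := by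
  obtain ⟨χ, hχs, hχ1, hχU, hχ0⟩ := exists_cutoff_sphere hU hρ hsub
  -- the diagonal entries vanish identically
  have hdiag : ∀ j z, A j j z = 0 := fun j z ↦ by linarith [hanti j j z]
  -- the cut-off family of bilinear forms
  set T : Fin 3 → Fin 3 → E3 →L[ℝ] E3 →L[ℝ] ℝ := fun i j ↦
    (EuclideanSpace.proj i : E3 →L[ℝ] ℝ).smulRight (EuclideanSpace.proj j : E3 →L[ℝ] ℝ) with hT
  set β : E3 → E3 →L[ℝ] E3 →L[ℝ] ℝ := fun z ↦ ∑ i, ∑ j, (χ z * A i j z) • T i j with hβ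
  have hβapply : ∀ z v w, β z v w = ∑ i, ∑ j, χ z * A i j z * v i * w j := fun z v w ↦
    sum_smul_smulRight_apply (fun i j ↦ χ z * A i j z) v w
  set b : OrthonormalBasis (Fin 3) ℝ E3 := EuclideanSpace.basisFun (Fin 3) ℝ with hb
  have hbi : ∀ i, b i = EuclideanSpace.single i 1 := fun i ↦ by simp [hb]
  have hβb : ∀ i j, (fun z ↦ β z (b i) (b j)) = fun z ↦ χ z * A i j z := fun i j ↦ by
    funext z
    rw [hbi, hbi]
    exact sum_smul_smulRight_single (fun i j ↦ χ z * A i j z) i j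
  -- `β` is `C²` everywhere
  have hβ2 : ContDiff ℝ 2 β := by
    refine contDiff_iff_contDiffAt.2 fun z ↦ ?_
    by_cases hz : z ∈ U
    · refine ContDiffAt.sum fun i _ ↦ ContDiffAt.sum fun j _ ↦ ?_
      have h1 : ContDiffAt ℝ 2 χ z := (hχs.of_le (WithTop.coe_le_coe.mpr le_top)).contDiffAt
      have h2 : ContDiffAt ℝ 2 (A i j) z := (hA i j).contDiffAt (hU.mem_nhds hz)
      exact (h1.mul h2).smul contDiffAt_const
    · have hzt : z ∉ tsupport χ := fun h ↦ hz (hχU h)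
      have h0 : β =ᶠ[𝓝 z] fun _ ↦ 0 := by
        filter_upwards [notMem_tsupport_iff_eventuallyEq.1 hzt] with y hy
        simp only [hβ, hy, Pi.zero_apply, zero_mul, zero_smul, Finset.sum_const_zero]
      exact contDiffAt_const.congr_of_eventuallyEq h0
  -- `β` is antisymmetric everywhere
  have hantiβ : ∀ y v w, β y v w = -β y w v := by
    intro y v w
    rw [hβapply, hβapply, Finset.sum_comm, ← Finset.sum_neg_distrib]
    refine Finset.sum_congr rfl fun j _ ↦ ?_
    rw [← Finset.sum_neg_distrib]
    refine Finset.sum_congr rfl fun i _ ↦ ?_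
    rw [hanti i j y]
    ring
  -- `β` vanishes on the closed ball of radius `ρ / 2`
  have hzero : ∀ y, ‖y‖ ≤ ρ / 2 → β y = 0 := by
    intro y hy
    ext v w
    rw [hβapply]
    simp [hχ0 y hy]
  -- the global statement
  have key := sphereIntegral_admVec_eq_zero_of_antisymm (volume : Measure E3) b
    (β := β) (c := fun y ↦ ∑ i, (∑ j, (fderiv ℝ (fun z ↦ β z (b i) (b j)) y (b j) -
      fderiv ℝ (fun z ↦ β z (b j) (b j)) y (b i))) • b i) (fun y ↦ rfl) hβ2 hantiβ
    (half_pos hρ) hzero hρ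
  rw [Literature.Analysis.FluidPDE.sphereIntegral_def] at key
  rw [← key]
  refine integral_congr_ae (ae_of_all _ fun α ↦ ?_)
  set z : E3 := ρ • (α : E3) with hz
  have hzmem : z ∈ sphere (0 : E3) ρ := by
    rw [mem_sphere_zero_iff_norm, hz, norm_smul, norm_eq_of_mem_sphere α, mul_one,
      Real.norm_of_nonneg hρ.le]
  have hnz : ‖z‖ = ρ := mem_sphere_zero_iff_norm.1 hzmem
  -- the components of the ADM vector of `β` at `z` are `Σ_j ∂_j A_{ij}(z)`
  have hc : ∀ i, ∑ j, (fderiv ℝ (fun z ↦ β z (b i) (b j)) z (b j) -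
      fderiv ℝ (fun z ↦ β z (b j) (b j)) z (b i)) =
      ∑ j, fderiv ℝ (A i j) z (EuclideanSpace.single j 1) := by
    intro i
    refine Finset.sum_congr rfl fun j _ ↦ ?_
    have h1 : (fun z ↦ β z (b i) (b j)) =ᶠ[𝓝 z] A i j := by
      rw [hβb]
      filter_upwards [hχ1 z hzmem] with y hy
      rw [hy, one_mul]
    have h2 : (fun z ↦ β z (b j) (b j)) = fun _ ↦ (0 : ℝ) := by
      rw [hβb]
      funext y
      rw [hdiag, mul_zero]
    rw [h1.fderiv_eq, h2, fderiv_const_apply, hbi, _root_.zero_apply, sub_zero]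
  simp only
  rw [real_inner_smul_left, inner_sum, Finset.mul_sum]
  refine Finset.sum_congr rfl fun i _ ↦ ?_
  rw [real_inner_smul_right, ← hz, hc i, hbi, EuclideanSpace.inner_single_right, one_mul,
    conj_trivial, hnz, hz, PiLp.smul_apply, smul_eq_mul]
  field_simp

/-- **Curl fields defined near a round sphere have no flux through it** — the registered
sub-goal form (stub `toSphere_integral_sum_fderiv_antisymm_eq_zero` of the crux item) of
`toSphere_integral_sum_fderiv_antisymm_eq_zero'`: Stokes' theorem on the closed surface `{‖z‖ = ρ}`
in flux form, for an antisymmetric matrix field `C²` near the sphere. [folklore] -/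
theorem toSphere_integral_sum_fderiv_antisymm_eq_zero : open Literature.Geometry.Lorentzian MeasureTheory Metric in ∀ (A : Fin 3 → Fin 3 → E3 → ℝ) (U : Set E3) (ρ : ℝ), IsOpen U → 0 < ρ → sphere (0 : E3) ρ ⊆ U → (∀ i j, ContDiffOn ℝ 2 (A i j) U) → (∀ i j z, A i j z = -A j i z) → ∫ α : sphere (0 : E3) 1, ∑ i : Fin 3, (∑ j : Fin 3, fderiv ℝ (A i j) (ρ • (α : E3)) (EuclideanSpace.single j 1)) * (α : E3) i ∂(volume : Measure E3).toSphere = 0 :=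
  fun _ _ _ hU hρ hs hA ha ↦ toSphere_integral_sum_fderiv_antisymm_eq_zero' hU hρ hs hA ha

end Summit.FinalStateConjecture.FinalStateConjecture.Theorems.SublinearIsFree.WindowCharges

end
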